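import Mathlib
import HarnessLib

/-!
# Local drop of the `p`-part of inertia along a line (crux `WildQuotients.WildQuotientResolution`, line `Sketch`)

Stub `stub_localDrop` of the skeleton `Sketch` for crux stmt-ResolutionOfSingularities-15640
(route `ResolutionOfSingularities/WildQuotients`, card `p-closure-sylow-separation`, §Lever (i)–(iii)):
the local engine of Phase 0 ("Sylow separation") at a point of the exceptional divisor `ℙ(W)`.
A finite group `I` (an inertia group) acts `κ`-linearly on `W` (the normal space, `char κ = p`)
through `τ : I →* Module.End κ W`; let `Π ≤ I` be the subgroup generated by the elements of
`p`-power order. If `Π` has no non-zero fixed vector (`W^Π = 0`), then for every `w ≠ 0` the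
subgroup generated by the `p`-power-order elements stabilising the LINE `κ w` (`τ g w = c • w`) is
STRICTLY smaller than `Π`.

Proof.
* `map_pow_apply_of_smul`: `τ g w = c • w` gives `τ (g ^ k) w = c ^ k • w`;
* `apply_eq_self_of_pow_prime_pow_eq_one`: if moreover `g ^ p ^ n = 1` then `w = c ^ p ^ n • w`,
  so `c ^ p ^ n = 1` (`w ≠ 0`), so `(c - 1) ^ p ^ n = c ^ p ^ n - 1 = 0` (`sub_pow_char_pow`) and
  `c = 1` (a field is reduced): `g` FIXES `w`
  (cf. `Literature.NumberTheory.Automorphic.eq_one_of_pow_prime_pow_eq_one`);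
* `apply_eq_self_of_mem_closure`: a subgroup generated by elements fixing `w` fixes `w`
  (`Subgroup.closure_induction`);
* `stub_localDrop`: the left closure is `≤ Π` by `Subgroup.closure_mono`; equality would make `Π`
  fix `w`, whence `w = 0` by `W^Π = 0`, contradicting `w ≠ 0` (`lt_of_le_of_ne`).
-/

-- single-problem summit: the doubled namespace component `ResolutionOfSingularities` is forced
set_option linter.dupNamespace false

namespace Summit.ResolutionOfSingularities.ResolutionOfSingularities.Theorems.WildQuotientResolution.LocalDrop

/-! ## Eigenvectors of `p`-power-order elements in characteristic `p` -/

/-- Powers act diagonally on an eigenvector: `τ g w = c • w` gives `τ (g ^ k) w = c ^ k • w`.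
[folklore] -/
theorem map_pow_apply_of_smul {κ W I : Type*} [Semiring κ] [AddCommMonoid W] [Module κ W]
    [Monoid I] (τ : I →* (W →ₗ[κ] W)) {g : I} {w : W} {c : κ} (hc : τ g w = c • w) (k : ℕ) :
    τ (g ^ k) w = c ^ k • w := by
  induction k with
  | zero => rw [pow_zero, pow_zero, map_one, Module.End.one_apply, one_smul]
  | succ k ih =>
    rw [pow_succ g k, map_mul, Module.End.mul_apply, hc, map_smul, ih, smul_smul, ← pow_succ' c k]

/-- **A `p`-power-order element stabilising a line fixes it pointwise** (`char κ = p`; card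
`p-closure-sylow-separation`, lemma `eigenvalue_eq_one_of_pow_char`): if `g ^ p ^ n = 1` and
`τ g w = c • w` with `w ≠ 0`, then `c ^ p ^ n • w = τ (g ^ p ^ n) w = w` forces `c ^ p ^ n = 1`,
hence `(c - 1) ^ p ^ n = c ^ p ^ n - 1 = 0` by Frobenius, hence `c = 1` and `τ g w = w`.
[folklore] -/
theorem apply_eq_self_of_pow_prime_pow_eq_one (p : ℕ) [Fact p.Prime] {κ W I : Type*} [Field κ]
    [CharP κ p] [AddCommGroup W] [Module κ W] [Monoid I] (τ : I →* (W →ₗ[κ] W)) {g : I} {n : ℕ}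
    (hg : g ^ p ^ n = 1) {w : W} (hw : w ≠ 0) {c : κ} (hc : τ g w = c • w) : τ g w = w := by
  have h1 : c ^ p ^ n • w = w := by
    rw [← map_pow_apply_of_smul τ hc, hg, map_one, Module.End.one_apply]
  have h2 : c ^ p ^ n = 1 := by
    have h : (c ^ p ^ n - 1) • w = 0 := by rw [sub_smul, one_smul, h1, sub_self]
    exact (smul_eq_zero.mp h).elim sub_eq_zero.mp fun h0 => absurd h0 hw
  have h3 : (c - 1) ^ p ^ n = 0 := by
    rw [sub_pow_char_pow (p := p) c 1 n, one_pow, h2, sub_self]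
  have h4 : c = 1 :=
    sub_eq_zero.mp ((pow_eq_zero_iff (pow_ne_zero n (Fact.out : p.Prime).ne_zero)).mp h3)
  rw [hc, h4, one_smul]

/-! ## Subgroups generated by elements fixing a vector -/

/-- **A subgroup generated by elements fixing `w` fixes `w`** (card `p-closure-sylow-separation`,
lemma `closure_le_stabilizer`): the stabiliser `{g | τ g w = w}` is a subgroup, so it contains
`Subgroup.closure s` as soon as it contains `s`. [folklore] -/
theorem apply_eq_self_of_mem_closure {κ W I : Type*} [Semiring κ] [AddCommMonoid W] [Module κ W]
    [Group I] (τ : I →* (W →ₗ[κ] W)) {s : Set I} {w : W} (hs : ∀ g ∈ s, τ g w = w) {g : I}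
    (hg : g ∈ Subgroup.closure s) : τ g w = w := by
  induction hg using Subgroup.closure_induction with
  | mem x hx => exact hs x hx
  | one => rw [map_one, Module.End.one_apply]
  | mul x y _ _ hx hy => rw [map_mul, Module.End.mul_apply, hy, hx]
  | inv x _ hx =>
    calc τ x⁻¹ w = τ x⁻¹ (τ x w) := by rw [hx]
      _ = w := by
        rw [← Module.End.mul_apply, ← map_mul, inv_mul_cancel, map_one, Module.End.one_apply]

/-! ## The local drop -/

/-- STUB `stub_localDrop` (M) — **Sylow separation, local form** (card `p-closure-sylow-separation`,
lemmas `eigenvalue_eq_one_of_pow_char`, `closure_le_stabilizer`, `closure_fixing_lt`): `κ` a field of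
characteristic `p`, `I` a finite group acting `κ`-linearly on `W` through `τ`, `Π ≤ I` the subgroup
generated by the elements of `p`-power order. If `Π` has no non-zero fixed vector (`W^Π = 0`) then for
every `w ≠ 0` the subgroup generated by the `p`-power-order elements `g` stabilising the line through `w`
(`τ g w = c • w`) is STRICTLY smaller than `Π`: such a `g` has `c ^ p ^ n = 1`, i.e. `(c - 1) ^ p ^ n = 0`,
so `c = 1` and `g` fixes `w` (`apply_eq_self_of_pow_prime_pow_eq_one`); a group generated by elements
fixing `w` fixes `w` (`apply_eq_self_of_mem_closure`); the inclusion is `Subgroup.closure_mono`, and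
equality with `Π` would force `w = 0`. [folklore; card p-closure-sylow-separation §Lever (i)–(iii)] -/
theorem stub_localDrop (p : ℕ) [Fact p.Prime] {κ W I : Type} [Field κ] [CharP κ p]
    [AddCommGroup W] [Module κ W] [Group I] [Finite I] (τ : I →* (W →ₗ[κ] W))
    (hfix : ∀ v : W,
      (∀ g ∈ Subgroup.closure {g : I | ∃ n : ℕ, g ^ p ^ n = 1}, τ g v = v) → v = 0)
    {w : W} (hw : w ≠ 0) :
    Subgroup.closure {g : I | (∃ n : ℕ, g ^ p ^ n = 1) ∧ ∃ c : κ, τ g w = c • w} <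
      Subgroup.closure {g : I | ∃ n : ℕ, g ^ p ^ n = 1} := by
  refine lt_of_le_of_ne (Subgroup.closure_mono fun g hg => hg.1) fun heq => hw (hfix w ?_)
  intro g hg
  rw [← heq] at hg
  refine apply_eq_self_of_mem_closure τ ?_ hg
  rintro x ⟨⟨n, hn⟩, c, hc⟩
  exact apply_eq_self_of_pow_prime_pow_eq_one p τ hn hw hc

end Summit.ResolutionOfSingularities.ResolutionOfSingularities.Theorems.WildQuotientResolution.LocalDrop
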